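import Mathlib
import Summits.Ventures.PercRepro2.TB14Fold
import Summits.Ventures.PercRepro2.TB14FlipFamily

/-!
# Row 2′TB (typed BHK 1.4 single-vertex): THE HALL DIRECTION (blind cell PercRepro2, p5 g5,
2026-08-25; S4 v24 §2.1 (g) W1′)

At a profile «`F` free, `z` pinned» the (TB14) slack `N(QAB, Q) − N(QB, QA)` is the number of
admissible SOURCES minus the number of admissible TARGETS (`tb14_slack_eq_card`; sources / targets in
the vocabulary of TB14FlipFamily: `IsSrc` / `IsTgt`).  Hence

* `tb14_of_card_le`: `#Src ≤ #Tgt` gives the row at the profile;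
* `tb14_of_injOn`: an INJECTION of the admissible sources into the admissible targets gives the row;
* `tb14_of_hall`: for ANY family of moves `moves y ⊆ Tgt` (`y ∈ Src`), HALL'S CONDITION
  `∀ S ⊆ Src, #S ≤ #(⋃_{y ∈ S} moves y)` gives the row (Mathlib's Hall theorem);
* `tb14_of_hall_starFlip`: the same at the all-free profile for a family of STAR FLIPS
  `y ↦ {starFlip Z y : Z ∈ fam y}` whose members are targets (e.g. any sub-family of the admissible
  flips of `isTgt_starFlip`).

This is the direction «Hall for a family of valid flips ⟹ the row» of S4 v24 §2.1 (g); the converse is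
FALSE for every family censused (exhaustive `n = 7`).  Nothing here proves (TB14); standard axioms.
-/

namespace Summit.Ventures.PercRepro2

namespace TB14Hall

open CovForm A3InactiveTyped TB14Fold TB14FlipFamily

section Count

variable {V : Type} {E : Type} [Fintype E] [DecidableEq E]
variable {R : Type*} [Field R] [LinearOrder R] [IsStrictOrderedRing R]
variable (ends : E → Sym2 V) (a₁ a₂ b o : V) (F : Finset E) (z : Config E)

open Classical in
/-- The admissible SOURCES at the profile: first copies agreeing with `z` off `F` that are sources. -/
noncomputable def srcSet : Finset (Config E) :=
  Finset.univ.filter fun y => (∀ e, e ∉ F → y e = z e) ∧ IsSrc ends a₁ a₂ b o F y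

open Classical in
/-- The admissible TARGETS at the profile. -/
noncomputable def tgtSet : Finset (Config E) :=
  Finset.univ.filter fun y => (∀ e, e ∉ F → y e = z e) ∧ IsTgt ends a₁ a₂ b o F y

omit [Fintype E] [DecidableEq E] [LinearOrder R] [IsStrictOrderedRing R] in
open Classical in
/-- `1_{b ∈ C₁}` through the cluster of `a₁`. -/
lemma iL_eq_ite (y : Config E) :
    (iL ends a₁ b y : R) = if b ∈ cluster ends y a₁ then 1 else 0 := by
  by_cases h : b ∈ cluster ends y a₁
  · rw [if_pos h]
    simp [iL, Set.indicator_of_mem (show y ∈ connEvent ends a₁ b from h)]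
  · rw [if_neg h]
    simp [iL, Set.indicator_of_notMem (show y ∉ connEvent ends a₁ b from h)]

omit [Fintype E] [LinearOrder R] [IsStrictOrderedRing R] in
open Classical in
/-- The folded summand on the pair `(y, flipOn F y)` is `1_{Src}(y) − 1_{Tgt}(y)`. -/
lemma foldBO_eq_ind (y : Config E) :
    (foldBO ends a₁ a₂ b o y (A3InactiveTyped.flipOn F y) : R) =
      (if IsSrc ends a₁ a₂ b o F y then 1 else 0) - (if IsTgt ends a₁ a₂ b o F y then 1 else 0) := by
  simp only [foldBO, iQ_eq_ite, iH_eq_ite, iL_eq_ite ends a₁ b]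
  have hS : IsSrc ends a₁ a₂ b o F y ↔
      (a₁ ∉ cluster ends y a₂ ∧ a₁ ∉ cluster ends (A3InactiveTyped.flipOn F y) a₂ ∧ b ∈ cluster ends y a₁ ∧
        o ∈ cluster ends y a₂ ∧ o ∉ cluster ends (A3InactiveTyped.flipOn F y) a₂) := by
    constructor
    · rintro ⟨q₁, q₂, hb, ho, ho'⟩
      exact ⟨fun h => q₁ (conn_symm h), fun h => q₂ (conn_symm h), hb, ho, ho'⟩
    · rintro ⟨q₁, q₂, hb, ho, ho'⟩
      exact ⟨fun h => q₁ (conn_symm h), fun h => q₂ (conn_symm h), hb, ho, ho'⟩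
  have hT : IsTgt ends a₁ a₂ b o F y ↔
      (a₁ ∉ cluster ends y a₂ ∧ a₁ ∉ cluster ends (A3InactiveTyped.flipOn F y) a₂ ∧ b ∈ cluster ends y a₁ ∧
        o ∈ cluster ends (A3InactiveTyped.flipOn F y) a₂ ∧ o ∉ cluster ends y a₂) := by
    constructor
    · rintro ⟨q₁, q₂, hb, ho, ho'⟩
      exact ⟨fun h => q₁ (conn_symm h), fun h => q₂ (conn_symm h), hb, ho, ho'⟩
    · rintro ⟨q₁, q₂, hb, ho, ho'⟩
      exact ⟨fun h => q₁ (conn_symm h), fun h => q₂ (conn_symm h), hb, ho, ho'⟩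
  simp only [hS, hT]
  by_cases h1 : a₁ ∈ cluster ends y a₂ <;> by_cases h2 : a₁ ∈ cluster ends (A3InactiveTyped.flipOn F y) a₂ <;>
    by_cases h3 : b ∈ cluster ends y a₁ <;> by_cases h4 : o ∈ cluster ends y a₂ <;>
    by_cases h5 : o ∈ cluster ends (A3InactiveTyped.flipOn F y) a₂ <;> simp [h1, h2, h3, h4, h5]

omit [LinearOrder R] [IsStrictOrderedRing R] in
/-- **The (TB14) slack is `#Src − #Tgt`** at the profile. -/
theorem tb14_slack_eq_card :
    pairCount F z (sameBO ends a₁ a₂ b o : Config E → Config E → R) -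
      pairCount F z (crossBO ends a₁ a₂ b o) =
      ((srcSet ends a₁ a₂ b o F z).card : R) - ((tgtSet ends a₁ a₂ b o F z).card : R) := by
  classical
  rw [pairCount_fold]
  unfold pairCount srcSet tgtSet
  rw [Finset.natCast_card_filter, Finset.natCast_card_filter, ← Finset.sum_sub_distrib]
  refine Finset.sum_congr rfl fun y _ => ?_
  rw [foldBO_eq_ind ends a₁ a₂ b o F y]
  by_cases h : ∀ e, e ∉ F → y e = z e
  · rw [if_pos h]
    split_ifs <;> simp_all
  · rw [if_neg h]
    split_ifs <;> simp_all

/-- `#Src ≤ #Tgt` at the profile gives the (TB14) inequality there. -/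
theorem tb14_of_card_le
    (h : (srcSet ends a₁ a₂ b o F z).card ≤ (tgtSet ends a₁ a₂ b o F z).card) :
    pairCount F z (sameBO ends a₁ a₂ b o : Config E → Config E → R) ≤
      pairCount F z (crossBO ends a₁ a₂ b o) := by
  rw [← sub_nonpos, tb14_slack_eq_card, sub_nonpos]
  exact_mod_cast h

/-- **An injection of the admissible sources into the admissible targets gives the row.** -/
theorem tb14_of_injOn (f : Config E → Config E)
    (hf : ∀ y ∈ srcSet ends a₁ a₂ b o F z, f y ∈ tgtSet ends a₁ a₂ b o F z)
    (hinj : Set.InjOn f (srcSet ends a₁ a₂ b o F z : Set (Config E))) :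
    pairCount F z (sameBO ends a₁ a₂ b o : Config E → Config E → R) ≤
      pairCount F z (crossBO ends a₁ a₂ b o) :=
  tb14_of_card_le ends a₁ a₂ b o F z (Finset.card_le_card_of_injOn f hf hinj)

/-- **HALL ⟹ THE ROW**: for any family of moves `moves y ⊆ Tgt` of the sources `y ∈ Src`, Hall's
condition on the bipartite graph `(Src, Tgt, moves)` gives the (TB14) inequality at the profile. -/
theorem tb14_of_hall (moves : Config E → Finset (Config E))
    (hmoves : ∀ y ∈ srcSet ends a₁ a₂ b o F z, moves y ⊆ tgtSet ends a₁ a₂ b o F z)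
    (hhall : ∀ S ⊆ srcSet ends a₁ a₂ b o F z, S.card ≤ (S.biUnion moves).card) :
    pairCount F z (sameBO ends a₁ a₂ b o : Config E → Config E → R) ≤
      pairCount F z (crossBO ends a₁ a₂ b o) := by
  classical
  -- Hall's theorem on the subtype of sources
  set Src := srcSet ends a₁ a₂ b o F z with hSrc
  have hhall' : ∀ s : Finset {y // y ∈ Src},
      s.card ≤ (s.biUnion fun y => moves y.1).card := by
    intro s
    have hsub : s.image Subtype.val ⊆ Src := by
      intro y hy
      obtain ⟨⟨y', hy'⟩, -, rfl⟩ := Finset.mem_image.1 hy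
      exact hy'
    have := hhall _ hsub
    rwa [Finset.card_image_of_injective s Subtype.val_injective, Finset.image_biUnion] at this
  obtain ⟨f, hfinj, hfmem⟩ := (Finset.all_card_le_biUnion_card_iff_exists_injective
    (fun y : {y // y ∈ Src} => moves y.1)).1 hhall'
  -- the injection into the targets
  have hfT : ∀ y : {y // y ∈ Src}, f y ∈ tgtSet ends a₁ a₂ b o F z :=
    fun y => hmoves y.1 y.2 (hfmem y)
  let g : {y // y ∈ Src} → {w // w ∈ tgtSet ends a₁ a₂ b o F z} := fun y => ⟨f y, hfT y⟩
  have hg : Function.Injective g := by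
    intro y y' h
    exact hfinj (congrArg Subtype.val h)
  have hcard := Fintype.card_le_of_injective g hg
  rw [Fintype.card_coe, Fintype.card_coe] at hcard
  exact tb14_of_card_le ends a₁ a₂ b o F z hcard

end Count

section StarFlips

variable {V : Type} {E : Type} [Fintype E] [DecidableEq E]
variable {R : Type*} [Field R] [LinearOrder R] [IsStrictOrderedRing R]
variable (ends : E → Sym2 V) (a₁ a₂ b o : V) (F : Finset E) (z : Config E)

omit [Fintype E] [DecidableEq E] in
/-- At the all-free profile every configuration is admissible. -/
lemma adm_of_allFree (hF : ∀ e, e ∈ F) (y : Config E) : ∀ e, e ∉ F → y e = z e :=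
  fun e he => absurd (hF e) he

open Classical in
/-- **HALL FOR A FAMILY OF STAR FLIPS ⟹ THE ROW (all-free profile).** `fam y` is any finite family
of vertex sets whose star flips of the source `y` are targets (for instance a sub-family of the
admissible flips of `isTgt_starFlip`); Hall's condition for the moves `y ↦ {starFlip Z y : Z ∈ fam y}`
gives (TB14) at the all-free profile. -/
theorem tb14_of_hall_starFlip (hF : ∀ e, e ∈ F) (fam : Config E → Finset (Finset V))
    (hfam : ∀ y, IsSrc ends a₁ a₂ b o F y → ∀ Z ∈ fam y, IsTgt ends a₁ a₂ b o F (starFlip ends Z y))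
    (hhall : ∀ S ⊆ srcSet ends a₁ a₂ b o F z,
      S.card ≤ (S.biUnion fun y => (fam y).image fun Z => starFlip ends Z y).card) :
    pairCount F z (sameBO ends a₁ a₂ b o : Config E → Config E → R) ≤
      pairCount F z (crossBO ends a₁ a₂ b o) := by
  refine tb14_of_hall ends a₁ a₂ b o F z (fun y => (fam y).image fun Z => starFlip ends Z y) ?_ hhall
  intro y hy w hw
  obtain ⟨Z, hZ, rfl⟩ := Finset.mem_image.1 hw
  have hy' : IsSrc ends a₁ a₂ b o F y := (Finset.mem_filter.1 hy).2.2
  exact Finset.mem_filter.2 ⟨Finset.mem_univ _, adm_of_allFree F z hF _, hfam y hy' Z hZ⟩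

end StarFlips

end TB14Hall

end Summit.Ventures.PercRepro2
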